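import Summits.ResolutionOfSingularities.ResolutionOfSingularities.Theorems.EquisingularLiftEquisingularLiftNatSpecimenConeCharts
import Literature.AlgebraicGeometry.Motives.HypersurfaceFormsNonsingular
import Literature.AlgebraicGeometry.Motives.NonsingularFormIrreducible
import Mathlib.RingTheory.MvPolynomial.EulerIdentity
import HarnessLib

/-!
# [OURS · L1 W4.5(b)] EL♮ FOR THE CONE OVER EVERY NONSINGULAR PLANE CURVE — the Jacobian form of the cone theorem
# (crux `Theses.EquisingularLift.EquisingularLiftNat`, stmt-ResolutionOfSingularities-20038)

NOT a statement of any manuscript; OURS kernel theorem (cell `res-hironaka`, chain w45b; seat res-D-pv-013, own initiative, counted 0). AI-written,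
weaker than expert review. No definition, no `sorry`, standard axioms.

`Cone.elNatAt_cone` (p524856) proves EL♮ for the cone `V₊(G(x₁,x₂,x₃)) ⊂ ℙ³_K` over a prime plane form `G` whose three affine charts
`K[T]/(G|_{Tᵢ := 1})` are regular rings. This file replaces that ring-regularity input by the tree's PROJECTIVE JACOBIAN CRITERION
`IsNonsingularForm K G` (`Motives/HypersurfaceFormsNonsingular`: `F` and its partials have no common zero in `ℙ²`; Hartshorne I Ex. 5.8):

* `pderiv_aeval_update_one` — for `j ≠ i`, `∂_j (G|_{Tᵢ := 1}) = (∂_j G)|_{Tᵢ := 1}` (dehomogenisation commutes with the other partials;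
  any index type);
* `aeval_update_one_pderiv_self_mem` — Euler: `(∂ᵢ G)|_{Tᵢ := 1} = d·G|_{Tᵢ:=1} − Σ_{j≠i} T_j (∂_j G)|_{Tᵢ:=1}` lies in every ideal containing
  `G|_{Tᵢ:=1}` and the `(∂_j G)|_{Tᵢ:=1}`, `j ≠ i`;
* **`isRegularRing_quotient_aeval_update_one_of_isNonsingularForm`** — a nonsingular form in `n + 2` variables (any `n`) has regular affine
  charts `K[T₀,…,T_{n+1}]/(G|_{Tᵢ := 1})` (Stacks 07PF with the derivations `∂/∂T_j`, `j ≠ i`: at a prime `Q ∋ G|_{Tᵢ:=1}` containing all these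
  partials, the pull-back `𝔭 = Q ∘ (Tᵢ := 1)` contains `G` and ALL `∂_m G`, so by nonsingularity `Tᵢ ∈ 𝔭`, i.e. `1 ∈ Q`);
* **`elNatAt_cone_of_isNonsingularForm`** — `Theorems.EquisingularLift.ELNatAt p K 3 (hypersurface (G(x₁,x₂,x₃))).left ι` for every
  NONSINGULAR plane form `G` of degree `d ≥ 1` over an algebraically closed `K` of characteristic `p`: the vertex of the cone over any smooth
  plane curve admits an equisingular-natural lift (`Cone.elNatAt_cone` + tree `IsNonsingularForm.prime`). Instances: Fermat forms with `p ∤ d`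
  (`isNonsingularForm_sum_X_pow`), smooth cubics (simple-elliptic `Ẽ₆` cone points), …

References: Hartshorne 1977 I Ex. 5.8/5.9; The Stacks Project 07PF; Mathlib `IsHomogeneous.sum_X_mul_pderiv` (Euler).
-/

set_option linter.dupNamespace false -- mandated namespace `Summit.<Summit>.<Problem>` of this single-conjunct summit

noncomputable section

open MvPolynomial
open Literature.AlgebraicGeometry.Resolution
open Literature.AlgebraicGeometry.Motives Literature.AlgebraicGeometry.Motives.SmoothHypersurface
open Summit.ResolutionOfSingularities.ResolutionOfSingularities.Theorems.EquisingularLift.SpecimenQuartic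

namespace Summit.ResolutionOfSingularities.ResolutionOfSingularities.Cruxes.EquisingularLiftNat.Sections

namespace Cone

variable (K : Type) [Field K]

/-! ## Dehomogenisation and partial derivatives -/

/-- **`∂_j` commutes with `Tᵢ := 1` for `j ≠ i`** (any index type). [folklore] -/
theorem pderiv_aeval_update_one {σ : Type*} [DecidableEq σ] (G : MvPolynomial σ K) (i j : σ) (hj : j ≠ i) :
    pderiv j (aeval (Function.update (X : σ → MvPolynomial σ K) i 1) G) =
      aeval (Function.update (X : σ → MvPolynomial σ K) i 1) (pderiv j G) := by
  induction G using MvPolynomial.induction_on with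
  | C a => simp
  | add p q hp hq => simp only [map_add, hp, hq]
  | mul_X p m hp =>
    have hXm : pderiv j (Function.update (X : σ → MvPolynomial σ K) i 1 m) =
        aeval (Function.update (X : σ → MvPolynomial σ K) i 1) (pderiv j (X m : MvPolynomial σ K)) := by
      by_cases hm : m = i
      · subst hm
        rw [Function.update_self, pderiv_X_of_ne hj.symm, map_zero, Derivation.map_one_eq_zero]
      · rw [Function.update_of_ne hm]
        by_cases hjm : j = m
        · subst hjm
          rw [pderiv_X_self, map_one]
        · rw [pderiv_X_of_ne (Ne.symm hjm), map_zero]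
    simp only [map_mul, aeval_X, Derivation.leibniz, smul_eq_mul, map_add, hp, hXm]

/-- **Euler at `Tᵢ := 1`**: for `G` homogeneous of degree `d` (finitely many variables), `(∂ᵢ G)|_{Tᵢ:=1}` lies in every ideal
containing `G|_{Tᵢ:=1}` and the `(∂_j G)|_{Tᵢ:=1}` for `j ≠ i` (from `Σ_m T_m ∂_m G = d·G`). [folklore] -/
theorem aeval_update_one_pderiv_self_mem {σ : Type*} [Fintype σ] [DecidableEq σ] (G : MvPolynomial σ K) {d : ℕ}
    (hG : G.IsHomogeneous d) (i : σ) (Q : Ideal (MvPolynomial σ K))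
    (hGQ : aeval (Function.update (X : σ → MvPolynomial σ K) i 1) G ∈ Q)
    (hdQ : ∀ j, j ≠ i → aeval (Function.update (X : σ → MvPolynomial σ K) i 1) (pderiv j G) ∈ Q) :
    aeval (Function.update (X : σ → MvPolynomial σ K) i 1) (pderiv i G) ∈ Q := by
  have heuler := congrArg (aeval (Function.update (X : σ → MvPolynomial σ K) i 1)) hG.sum_X_mul_pderiv
  rw [map_sum, map_nsmul] at heuler
  simp only [map_mul, aeval_X] at heuler
  -- isolate the `i`-th summand: `1 · (∂ᵢ G)| = d • G| − Σ_{j ≠ i} T_j · (∂_j G)|`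
  rw [← Finset.add_sum_erase _ _ (Finset.mem_univ i), Function.update_self, one_mul] at heuler
  have h : aeval (Function.update (X : σ → MvPolynomial σ K) i 1) (pderiv i G) =
      d • aeval (Function.update (X : σ → MvPolynomial σ K) i 1) G -
        ∑ j ∈ Finset.univ.erase i, Function.update (X : σ → MvPolynomial σ K) i 1 j *
          aeval (Function.update (X : σ → MvPolynomial σ K) i 1) (pderiv j G) := by
    rw [← heuler]; ring
  rw [h]
  refine Q.sub_mem (by rw [nsmul_eq_mul]; exact Q.mul_mem_left _ hGQ) (Q.sum_mem fun j hj => ?_)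
  exact Q.mul_mem_left _ (hdQ j (Finset.ne_of_mem_erase hj))

/-! ## Nonsingular forms have regular affine charts -/

/-- **A NONSINGULAR form has regular affine charts**: `K[T₀,…,T_{n+1}]/(G|_{Tᵢ := 1})` is a regular ring for `G` homogeneous with
`IsNonsingularForm K G` (Stacks 07PF: at a prime `Q ∋ G|_{Tᵢ:=1}` some `∂/∂T_j`, `j ≠ i`, takes `G|_{Tᵢ:=1}` outside `Q` — else the
pull-back prime `Q ∘ (Tᵢ := 1)` contains `G` and all its partials, hence `Tᵢ`, i.e. `1 ∈ Q`). Note the quotient keeps the idle variable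
`Tᵢ`: it is the polynomial ring in `Tᵢ` over the usual affine chart ring. [cite: Hartshorne1977, I Ex. 5.8] -/
theorem isRegularRing_quotient_aeval_update_one_of_isNonsingularForm {n : ℕ} (G : MvPolynomial (Fin (n + 2)) K) {d : ℕ}
    (hG : G.IsHomogeneous d) (hns : IsNonsingularForm K G) (i : Fin (n + 2)) :
    IsRegularRing (MvPolynomial (Fin (n + 2)) K ⧸
      Ideal.span {aeval (Function.update (X : Fin (n + 2) → MvPolynomial (Fin (n + 2)) K) i 1) G}) := by
  refine isRegularRing_quotient_of_derivations (S₀ := K) _ fun Q hQ hgQ => ?_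
  by_contra hnone
  simp only [not_exists, not_not] at hnone
  -- all partials `j ≠ i` of `G|` lie in `Q`, hence (Euler) so does `(∂ᵢ G)|`
  have hdQ : ∀ j, j ≠ i →
      aeval (Function.update (X : Fin (n + 2) → MvPolynomial (Fin (n + 2)) K) i 1) (pderiv j G) ∈ Q := by
    intro j hj
    rw [← pderiv_aeval_update_one K G i j hj]
    exact hnone _
  have hiQ := aeval_update_one_pderiv_self_mem K G hG i Q hgQ hdQ
  -- the pull-back prime `𝔭 = Q.comap (Tᵢ := 1)` contains `G` and all `∂_m G`
  let φ : MvPolynomial (Fin (n + 2)) K →ₐ[K] MvPolynomial (Fin (n + 2)) K :=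
    aeval (Function.update (X : Fin (n + 2) → MvPolynomial (Fin (n + 2)) K) i 1)
  haveI : (Q.comap φ).IsPrime := Ideal.comap_isPrime φ Q
  have hall : ∀ m : Fin (n + 2), (X m : MvPolynomial (Fin (n + 2)) K) ∈ Q.comap φ :=
    hns (Q.comap φ) inferInstance hgQ (fun m => by
      by_cases hm : m = i
      · subst hm; exact hiQ
      · exact hdQ m hm)
  have h1 : (1 : MvPolynomial (Fin (n + 2)) K) ∈ Q := by
    have h := hall i
    rw [Ideal.mem_comap] at h
    change aeval (Function.update (X : Fin (n + 2) → MvPolynomial (Fin (n + 2)) K) i 1) (X i) ∈ Q at h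
    rwa [aeval_X, Function.update_self] at h
  exact hQ.ne_top ((Ideal.eq_top_iff_one _).mpr h1)

/-! ## EL♮ for the cone over every nonsingular plane curve -/

attribute [local instance] MvPolynomial.gradedAlgebra Literature.AlgebraicGeometry.Motives.ProjBaseChange.algebraBase in
/-- **EL♮ HOLDS FOR THE CONE OVER EVERY NONSINGULAR PLANE CURVE.** For `G ∈ K[T₀,T₁,T₂]` homogeneous of degree `d ≥ 1` satisfying the
projective Jacobian criterion `IsNonsingularForm K G` (`K` algebraically closed of characteristic `p`), the cone
`H = V₊(G(x₁,x₂,x₃)) ⊂ ℙ³_K` — an integral surface whose only singular point is the vertex `[1:0:0:0]`, an ordinary `d`-fold point — satisfies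
`Theorems.EquisingularLift.ELNatAt p K 3 H ι` (p503491): `Cone.elNatAt_cone` (p524856; one horizontal E1 step = the section through the vertex)
fed with `IsNonsingularForm.prime` (tree) and the regular charts of the previous theorem. [OURS · L1 W4.5b] [folklore] -/
theorem elNatAt_cone_of_isNonsingularForm (p : ℕ) (hp : p.Prime) (K : Type) [Field K] [CharP K p] [IsAlgClosed K]
    (G : MvPolynomial (Fin 3) K) {d : ℕ} (hG : G.IsHomogeneous d) (hd : 1 ≤ d) (hns : IsNonsingularForm K G) :
    Theorems.EquisingularLift.ELNatAt p K 3 (hypersurface (rename Fin.succ G : MvPolynomial (Fin 4) K)).left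
      (hypersurfaceι (rename Fin.succ G : MvPolynomial (Fin 4) K)).left :=
  elNatAt_cone p hp K G hG (hns.prime le_rfl hd hG)
    (isRegularRing_quotient_aeval_update_one_of_isNonsingularForm K G hG hns)

/-- **Instance: the Fermat cones once more** (`G = T₀ᵈ + T₁ᵈ + T₂ᵈ`, `p ∤ d`), now in two lines from the tree's
`isNonsingularForm_sum_X_pow` — a third derivation of `FermatCone.elNatAt_fermatCone` (p518711), through the Jacobian form of the
cone theorem. [folklore] -/
theorem elNatAt_fermatCone_of_isNonsingularForm (d p : ℕ) (hp : p.Prime) (K : Type) [Field K] [CharP K p] [IsAlgClosed K]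
    (hdK : (d : K) ≠ 0) :
    Theorems.EquisingularLift.ELNatAt p K 3
      (hypersurface (rename Fin.succ (∑ i : Fin 3, (X i : MvPolynomial (Fin 3) K) ^ d) : MvPolynomial (Fin 4) K)).left
      (hypersurfaceι (rename Fin.succ (∑ i : Fin 3, (X i : MvPolynomial (Fin 3) K) ^ d) : MvPolynomial (Fin 4) K)).left := by
  have hd : 1 ≤ d := Nat.one_le_iff_ne_zero.mpr (by rintro rfl; exact hdK (by simp))
  have hG : (∑ i : Fin 3, (X i : MvPolynomial (Fin 3) K) ^ d).IsHomogeneous d :=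
    IsHomogeneous.sum _ _ _ fun i _ => by simpa using (isHomogeneous_X K i).pow d
  exact elNatAt_cone_of_isNonsingularForm p hp K _ hG hd (isNonsingularForm_sum_X_pow (n := 1) hdK)

end Cone

end Summit.ResolutionOfSingularities.ResolutionOfSingularities.Cruxes.EquisingularLiftNat.Sections

end
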